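import Literature.NumberTheory.ComplexMultiplication.CMTypeRiemannForm
import HarnessLib

/-!
# The unitary torus `U_F` of a quartic CM field with no imaginary quadratic subfield is `ℚ`-simple — Lie form on skew elements (Moonen–Zarhin 1999 §4 / (5.10): «`Hg(Y₁) = U_{F₁}` … a `ℚ`-simple algebraic torus»)

Layer `Literature/NumberTheory/ComplexMultiplication`; KERNEL ONLY (theorems; no definition, no named fact; D-0026).
Research context: cell `pub-hodge-ring2` (HONEST FRAMING: research route conditional on HC_CM; not a corollary;
Q11.4-sentence-2 already refuted in dim ≥ 3), Literature lane, programme R28b «row (5.10) `S × T` of Moonen–Zarhin's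
Thm. 0.2 (4): `S` a simple CM abelian surface, `T` a simple threefold of type IV not of CM type» — the number-theoretic
input of Lemma (3.6) for `X₂ = S` (plan: `pub-hodge-ring2-lit-g60/R28B-APPROACH.md` (N)). UNCONDITIONAL.

THE PRINT. B. Moonen, Yu. Zarhin, *Hodge classes on abelian varieties of low dimension*, Math. Ann. 315 (1999)
[held `paper:arxiv-math_9901113`]: Lemma (3.6) (chunk p0007 L16–L28) «Assume that the Hodge group `Hg(X₂)` is a
`ℚ`-simple algebraic torus. (In particular `X₂` is of CM-type.) … The assumption that `Hg(X₂)` is `ℚ`-simple implies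
that `hg(X₂)` does not contain a proper algebraic Lie subalgebra»; §5 (5.10) (chunk p0010 L18–L40) «`Y₁` is of CM-type
with `Hg(Y₁) = U_{F₁}`, where `F₁ = End⁰(Y₁)` … `Ω₁ = F₁` and `Gal(Ω₁/ℚ) = ℤ/4ℤ` (as `F₁` does not contain an imaginary
quadratic field), or `Ω₁` has degree 8»; §2 (2.1)–(2.2) (chunk p0005): `U_F = Ker(Nm : T_F → T_{F₀})`,
`Lie U_F = F⁻ = {y ∈ F : ȳ = -y}`, characters of `T_F` = `ℤ[Hom(F, ℂ)]`. G. Shimura, *Abelian Varieties with Complex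
Multiplication and Modular Functions* (1998) §8.4 Example (2): a quartic CM field `K = K₀(ξ)` is biquadratic iff it
contains an imaginary quadratic field `K*`, and then no CM type of `K` is primitive (the tree's
`QuarticCMTypes.isPrimitive_iff_not_biquadratic`).

LIE FORM PROVED HERE. A character `χ = Σ_φ n_φ [φ]` (`n : Hom(F,ℂ) → ℚ`) of the torus `T_F = Res_{F/ℚ} 𝔾_m` has
differential `dχ(y) = Σ_φ n_φ φ(y)` on `Lie T_F = F`; on `Lie U_F = F⁻` it is `(n_σ - n_σ̄) σ(y) + (n_τ - n_τ̄) τ(y)` for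
the two conjugate pairs `{σ, σ̄}, {τ, τ̄}` of embeddings. **`QuarticCM.sum_mul_apply_eq_zero_of_skew`**: if `F` is a
quartic CM field, `y₁ ∈ F⁻` is non-zero with `y₁² ∉ ℚ` (i.e. `ℚ(y₁)` is NOT an imaginary quadratic subfield of `F`),
and `dχ(y₁) = 0`, then `dχ` vanishes on all of `F⁻` — the Lie algebra of every `ℚ`-subgroup `∩ Ker χ` of `U_F` meeting
`Lie U_F` non-trivially is all of `Lie U_F`: «`hg(X₂) = Lie U_F` does not contain a proper algebraic Lie subalgebra».
Mechanism (**`QuarticCM.ratCast_mul_apply_add_ne_zero_of_skew`**): if `m₁σ(y) + m₂τ(y) = 0` with `(m₁, m₂) ≠ 0` then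
`τ(y) = ρσ(y)` (`ρ ∈ ℚ`), so `u = y²` (fixed by conjugation) has `τ(u) = ρ²σ(u)` and
`Tr_{F/ℚ}(u) = σ(u) + σ̄(u) + τ(u) + τ̄(u) = 2(1 + ρ²)σ(u)`, whence `σ(u) ∈ ℚ` and `y² = u ∈ ℚ` — excluded. (For `F`
cyclic this is Moonen–Zarhin's «`Gal = ℤ/4ℤ`»: `τ = σ ∘ g`, `g² = ` conjugation, `g y = ρ y ⇒ -y = ρ²y`.)

## References

* [MoonenZarhin1999LowDim] B. Moonen, Yu. Zarhin, Math. Ann. 315 (1999), §2 (2.1)–(2.2), §3 Lemma (3.6), §4, §5 (5.10)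
  (held `paper:arxiv-math_9901113` chunks p0005, p0007, p0010). [cite: MoonenZarhin1999LowDim, §3 Lemma (3.6) and §5 (5.10)]
* [Shimura1998] G. Shimura, *Abelian Varieties with Complex Multiplication and Modular Functions* (1998), §8.4 Example
  (2)(A)–(C). [cite: Shimura1998, §8.4 Example (2)]
-/

noncomputable section

open NumberField NumberField.ComplexEmbedding

namespace Literature.NumberTheory.ComplexMultiplication

namespace QuarticCM

variable {F : Type*} [Field F] [NumberField F] [IsCMField F]

/-- A skew element (`ȳ = -y`) is purely imaginary at every embedding: `σ̄(y) = -σ(y)`.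
[cite: MoonenZarhin1999LowDim, §2 (2.1)] [cite: Shimura1998, §6.2 (proof of Thm. 3, p. 44)] -/
theorem conjugate_apply_eq_neg_of_skew (σ : F →+* ℂ) {y : F} (hy : IsCMField.complexConj F y = -y) :
    conjugate σ y = -σ y := by
  rw [conjugate_coe_eq, ← IsCMField.complexEmbedding_complexConj F σ y, hy, map_neg]

/-- A real element (`ū = u`) is real at every embedding: `σ̄(u) = σ(u)`. [cite: MoonenZarhin1999LowDim, §2 (2.1)] -/
theorem conjugate_apply_eq_of_real (σ : F →+* ℂ) {u : F} (hu : IsCMField.complexConj F u = u) :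
    conjugate σ u = σ u := by
  rw [conjugate_coe_eq, ← IsCMField.complexEmbedding_complexConj F σ u, hu]

/-- In a CM field no embedding is real: `σ̄ ≠ σ`. [cite: Shimura1998, §8.4 Example (2)] -/
theorem conjugate_ne_self (σ : F →+* ℂ) : conjugate σ ≠ σ := by
  haveI : IsTotallyComplex F := IsCMField.to_isTotallyComplex
  exact fun h => IsTotallyComplex.complexEmbedding_not_isReal σ (isReal_iff.2 h)

omit [IsCMField F] in
/-- `Tr_{F/ℚ}(u) = Σ_φ φ(u)` over the complex embeddings (as ring maps). [cite: Shimura1998, §6.2 (proof of Thm. 3, p. 44)] -/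
theorem algebraMap_trace_eq_sum_apply (u : F) :
    algebraMap ℚ ℂ (Algebra.trace ℚ F u) = ∑ φ : F →+* ℂ, φ u := by
  rw [trace_eq_sum_embeddings ℂ (K := ℚ) (L := F), ← Fintype.sum_equiv RingHom.equivRatAlgHom (fun σ : F →+* ℂ => σ u)
    (fun σ : F →ₐ[ℚ] ℂ => σ u) (fun σ => by simp [RingHom.equivRatAlgHom_apply])]

/-- **For a quartic CM field the four embeddings are `σ, σ̄, τ, τ̄`** for any `τ ∉ {σ, σ̄}`: a sum over all embeddings
is the sum of these four terms. [cite: Shimura1998, §8.4 Example (2)] [cite: MoonenZarhin1999LowDim, §2 (2.1)–(2.2)] -/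
theorem sum_eq_four_of_finrank_eq_four (h4 : Module.finrank ℚ F = 4) {σ τ : F →+* ℂ} (hτσ : τ ≠ σ)
    (hτσ' : τ ≠ conjugate σ) (f : (F →+* ℂ) → ℂ) :
    ∑ φ : F →+* ℂ, f φ = f σ + f (conjugate σ) + f τ + f (conjugate τ) := by
  classical
  have hinv : Function.Involutive (conjugate : (F →+* ℂ) → (F →+* ℂ)) := involutive_conjugate F
  -- pairwise distinctness
  have h1 : σ ≠ conjugate σ := (conjugate_ne_self σ).symm
  have h2 : σ ≠ τ := hτσ.symm
  have h3 : σ ≠ conjugate τ := fun h => hτσ' (by rw [h, hinv τ])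
  have h4' : conjugate σ ≠ τ := fun h => hτσ' h.symm
  have h5 : conjugate σ ≠ conjugate τ := fun h => hτσ (hinv.injective h).symm
  have h6 : τ ≠ conjugate τ := (conjugate_ne_self τ).symm
  -- the four-element set is everything
  have hcard : Fintype.card (F →+* ℂ) = 4 := by rw [NumberField.Embeddings.card, h4]
  have hS : ({σ, conjugate σ, τ, conjugate τ} : Finset (F →+* ℂ)) = Finset.univ := by
    apply Finset.eq_univ_of_card
    rw [Finset.card_insert_of_notMem (by simp [h1, h2, h3]), Finset.card_insert_of_notMem (by simp [h4', h5]),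
      Finset.card_pair h6, hcard]
  rw [← hS, Finset.sum_insert (by simp [h1, h2, h3]), Finset.sum_insert (by simp [h4', h5]), Finset.sum_pair h6]
  ring

/-- **A non-trivial rational relation `m₁σ(y) + m₂τ(y) = 0` between the values of a non-zero skew `y` at two
non-conjugate embeddings forces `y² ∈ ℚ`** (quartic CM field): otherwise `τ(y) = ρσ(y)` with `ρ ∈ ℚ`, `u = y²` is
fixed by conjugation with `τ(u) = ρ²σ(u)`, and `Tr(u) = 2(1 + ρ²)σ(u)` puts `σ(u)`, hence `u`, in `ℚ`. Equivalently: for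
`y ∈ F⁻ \ {0}` with `y² ∉ ℚ` (no imaginary quadratic subfield `ℚ(y) ⊆ F`), `σ(y)` and `τ(y)` are `ℚ`-linearly
independent. (Moonen–Zarhin: «`Gal(Ω₁/ℚ) = ℤ/4ℤ` (as `F₁` does not contain an imaginary quadratic field), or `Ω₁` has
degree 8» — the splitting field of `U_{F₁}` does not degenerate.) [cite: MoonenZarhin1999LowDim, §5 (5.10)]
[cite: Shimura1998, §8.4 Example (2)] -/
theorem ratCast_mul_apply_add_ne_zero_of_skew (h4 : Module.finrank ℚ F = 4) {σ τ : F →+* ℂ} (hτσ : τ ≠ σ)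
    (hτσ' : τ ≠ conjugate σ) {y : F} (hy0 : y ≠ 0) (hys : IsCMField.complexConj F y = -y)
    (hysq : ∀ r : ℚ, y * y ≠ algebraMap ℚ F r) {m₁ m₂ : ℚ} (hm : m₁ ≠ 0 ∨ m₂ ≠ 0) :
    (m₁ : ℂ) * σ y + (m₂ : ℂ) * τ y ≠ 0 := by
  intro h
  have hσy : σ y ≠ 0 := fun h0 => hy0 (σ.injective (by rw [h0, map_zero]))
  have hτy : τ y ≠ 0 := fun h0 => hy0 (τ.injective (by rw [h0, map_zero]))
  -- `m₂ ≠ 0` (and `m₁ ≠ 0`)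
  have hm₂ : m₂ ≠ 0 := by
    rintro rfl
    have hm₁ : m₁ ≠ 0 := hm.resolve_right (not_not.2 rfl)
    rw [Rat.cast_zero, zero_mul, add_zero] at h
    exact (mul_ne_zero (Rat.cast_ne_zero.2 hm₁) hσy) h
  -- `τ y = ρ σ y`
  set ρ : ℚ := -m₁ / m₂ with hρ
  have hτ : τ y = (ρ : ℂ) * σ y := by
    have hm₂C : (m₂ : ℂ) ≠ 0 := Rat.cast_ne_zero.2 hm₂
    rw [hρ, Rat.cast_div, Rat.cast_neg]
    field_simp
    linear_combination h
  -- `u = y²` is real with `τ u = ρ² σ u`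
  set u : F := y * y with hu
  have hureal : IsCMField.complexConj F u = u := by rw [hu, map_mul, hys, neg_mul_neg]
  have hτu : τ u = (ρ : ℂ) ^ 2 * σ u := by rw [hu, map_mul, map_mul, hτ]; ring
  -- the trace
  have htr := algebraMap_trace_eq_sum_apply u
  rw [sum_eq_four_of_finrank_eq_four h4 hτσ hτσ' (fun φ => φ u), conjugate_apply_eq_of_real σ hureal,
    conjugate_apply_eq_of_real τ hureal, hτu] at htr
  -- `σ u` is rational
  set t : ℚ := Algebra.trace ℚ F u with ht
  have h1ρ : (2 : ℂ) * (1 + (ρ : ℂ) ^ 2) ≠ 0 := by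
    have : (0 : ℝ) < 2 * (1 + (ρ : ℝ) ^ 2) := by positivity
    have h' : ((2 * (1 + (ρ : ℝ) ^ 2) : ℝ) : ℂ) ≠ 0 := Complex.ofReal_ne_zero.2 this.ne'
    push_cast at h'
    exact h'
  have hσu : σ u = ((t / (2 * (1 + ρ ^ 2)) : ℚ) : ℂ) := by
    have e : algebraMap ℚ ℂ t = (t : ℂ) := by rw [eq_ratCast]
    rw [e] at htr
    push_cast
    rw [eq_div_iff h1ρ]
    linear_combination -htr
  -- hence `u` is rational
  apply hysq (t / (2 * (1 + ρ ^ 2)))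
  apply σ.injective
  rw [hσu]
  exact (eq_ratCast (σ.comp (algebraMap ℚ F)) _).symm

/-- **Theorem (`U_F` is `ℚ`-simple, Lie form; Moonen–Zarhin Lemma (3.6) input for a simple CM surface).** Let `F` be a
quartic CM field and `y₁ ∈ F⁻ = Lie U_F` a non-zero skew element with `y₁² ∉ ℚ` (i.e. `ℚ(y₁)` is not an imaginary
quadratic subfield). If the differential `dχ(y) = Σ_φ n_φ φ(y)` of a rational character `χ = Σ_φ n_φ[φ]` of `T_F`
vanishes at `y₁`, it vanishes on all of `F⁻`: «`hg(X₂) = Lie U_F` does not contain a proper algebraic Lie subalgebra».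
(`dχ|_{F⁻} = (n_σ - n_σ̄)σ + (n_τ - n_τ̄)τ`, and the previous lemma.) [cite: MoonenZarhin1999LowDim, §3 Lemma (3.6) and §5 (5.10)]
[cite: Shimura1998, §8.4 Example (2)] -/
theorem sum_mul_apply_eq_zero_of_skew (h4 : Module.finrank ℚ F = 4) (n : (F →+* ℂ) → ℚ) {y₁ : F} (hy0 : y₁ ≠ 0)
    (hys : IsCMField.complexConj F y₁ = -y₁) (hysq : ∀ r : ℚ, y₁ * y₁ ≠ algebraMap ℚ F r)
    (h0 : ∑ φ : F →+* ℂ, (n φ : ℂ) * φ y₁ = 0) {y : F} (hy : IsCMField.complexConj F y = -y) :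
    ∑ φ : F →+* ℂ, (n φ : ℂ) * φ y = 0 := by
  classical
  -- two non-conjugate embeddings `σ`, `τ`
  obtain ⟨σ⟩ : Nonempty (F →+* ℂ) := inferInstance
  have hcard : Fintype.card (F →+* ℂ) = 4 := by rw [NumberField.Embeddings.card, h4]
  obtain ⟨τ, hτ⟩ : ∃ τ : F →+* ℂ, τ ∉ ({σ, conjugate σ} : Finset (F →+* ℂ)) := by
    by_contra! hall
    have hle : Finset.univ ⊆ ({σ, conjugate σ} : Finset (F →+* ℂ)) := fun τ _ => hall τ
    have := Finset.card_le_card hle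
    rw [Finset.card_univ, hcard] at this
    exact absurd (this.trans (Finset.card_insert_le _ _)) (by simp)
  simp only [Finset.mem_insert, Finset.mem_singleton, not_or] at hτ
  obtain ⟨hτσ, hτσ'⟩ := hτ
  -- `dχ` on skew elements
  have key : ∀ {z : F}, IsCMField.complexConj F z = -z →
      ∑ φ : F →+* ℂ, (n φ : ℂ) * φ z =
        ((n σ - n (conjugate σ) : ℚ) : ℂ) * σ z + ((n τ - n (conjugate τ) : ℚ) : ℂ) * τ z := by
    intro z hz
    rw [sum_eq_four_of_finrank_eq_four h4 hτσ hτσ' (fun φ => (n φ : ℂ) * φ z), conjugate_apply_eq_neg_of_skew σ hz,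
      conjugate_apply_eq_neg_of_skew τ hz]
    push_cast
    ring
  rw [key hy]
  rw [key hys] at h0
  by_cases hm : (n σ - n (conjugate σ)) ≠ 0 ∨ (n τ - n (conjugate τ)) ≠ 0
  · exact absurd h0 (ratCast_mul_apply_add_ne_zero_of_skew h4 hτσ hτσ' hy0 hys hysq hm)
  · simp only [not_or, not_not] at hm
    rw [hm.1, hm.2, Rat.cast_zero, zero_mul, zero_mul, add_zero]

end QuarticCM

end Literature.NumberTheory.ComplexMultiplication

end
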